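import Summits.ValiantsHypothesis.ValiantsHypothesis.Theses.SummationBits

/-!
# Birth skeleton (BC3) for crux `SummationBits.RyserOptimalDepth3` (stmt-ValiantsHypothesis-7565)

Route `route-ValiantsHypothesis-SummationBits`, crux rank 3 (route decl
`Summit.ValiantsHypothesis.ValiantsHypothesis.Theses.SummationBits.RyserOptimalDepth3`):
there is `c` such that for all `n ≥ 1` every affine depth-three expression
`per_n = Σ_{i<r} Π_{j<D} ℓ_ij` (`ℓ_ij ∈ ℂ[x]`, total degree `≤ 1`) has `2^n ≤ r·(D+1)·(n+2)^c`
— Ryser/Glynn (`r = 2^n − 1`, resp. `2^(n-1)`, `D = n`) are optimal up to `poly(n)`.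

## Line `birth` — degree dial: flattening regime + elementary-symmetric normal form + the heart

The route's own two-layer plan ("BoundedDegreeRyser → InterpolationRegime → RyserOptimalDepth3"),
recalibrated to what flattenings actually certify at the `2^n/poly(n)` level, and with the
interpolation (Ben-Or) regime TRANSFERRED to the elementary-symmetric model of depth three
(Shpilka's "symmetric model"; the exact analogue of the graded e-system of the sibling skeleton
`Cruxes/ChowBorderBound/Lines/birth.lean`):

* **Stub F `stub_flatteningRegime`** (TRUE — provable now; size M).  For every `t` some `c(t)`:
  if `D ≤ n + t·⌊log₂(n+2)⌋` then `2^n ≤ r (D+1) (n+2)^c`.  Plan: the order-`k` partials of a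
  product of `D` affine forms lie in the span of its `binom(D, D-k)` sub-products (tree, PROVED for
  any finite index type: `Summit.ValiantsHypothesis.SummationBits.iterPDeriv_prod_mem_span`,
  SummationBitsHomogeneousRung.lean), those of `per_n` span `binom(n,k)²` dimensions (tree, PROVED:
  `Literature.Barriers.ValiantsHypothesis.flatteningRank_perPoly`); at `k = ⌊n/2⌋`,
  `binom(n,k)² ≤ r · binom(D,k) ≤ r · 2^(D-n) · binom(n,k)` (`binom(N+1,k) ≤ 2 binom(N,k)` for
  `2k ≤ N+1`), so `2^n/(n+1) ≤ binom(n,k) ≤ r · 2^(t⌊log₂(n+2)⌋) ≤ r (n+2)^t`; `c = t + 1` works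
  (`D < ⌊n/2⌋` only makes the span smaller).  This is `HomogeneousRung` (item 7569, PROVED) pushed
  from `D = n` to `D = n + O(log n)`, which is exactly as far as flattenings reach at the `2^n/poly`
  level (at `D = n + s` they lose the factor `2^s`).
* **Stub N `stub_esymNormalForm`** (TRUE — provable now; size M).  An affine expression with
  parameters `(r, D)` yields scalars `a_i` and LINEAR forms `m_ij` (homogeneous of degree 1) with
  `Σ_{i<r} a_i · e_n(m_i1, …, m_iD) = per_n` — same `r`, same `D`
  (`e_n(m_i) = aeval (m i) (MvPolynomial.esymm (Fin D) ℂ n)`).  Plan: translate `x ↦ x + u` by a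
  `u ∈ ℂ^(n×n)` with `ℓ_ij(u) ≠ 0` for every non-zero factor (exists: `ℂ` infinite,
  `MvPolynomial.funext` applied to the product of the non-zero factors); then
  `Π_j ℓ_ij(x+u) = a_i Π_j (1 + m_ij)` with `a_i = Π_j ℓ_ij(u)`, `m_ij = (ℓ_ij(x+u) − ℓ_ij(u))/ℓ_ij(u)`
  (summands with a zero factor: `a_i = 0`, `m_ij = 0`); take the degree-`n` homogeneous component:
  `[Π_j (1 + m_ij)]_n = e_n(m_i)` (tree, PROVED:
  `Summit.ValiantsHypothesis.ValiantsHypothesis.Theorems.homogeneousComponent_prod_one_add`,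
  ChowBorderDepth3LocalFanInTwoNewton.lean) and `[per_n(x+u)]_n = per_n(x)` (top component is
  translation invariant).
* **Stub H `stub_esymHighDegree`** (OPEN — the heart).  For some `t, c`: every representation
  `Σ_{i<r} a_i e_n(m_i1, …, m_iD) = per_n` by elementary symmetric polynomials of degree `n` in
  `D > n + t⌊log₂(n+2)⌋` linear forms has `2^n ≤ r (D+1) (n+2)^c`.  This is the interpolation
  regime of the crux in symmetric normal form, and slightly MORE: it keeps only the degree-`n`
  identity (the identities `Σ_i a_i e_k(m_i) = [per_n(x+u)]_k`, `k ≠ n`, that an affine expression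
  also satisfies are forgotten), and it charges `D+1` once, whereas converting an e-representation
  back into an affine ΣΠΣ expression (Ben-Or interpolation over `D+1` scalings) costs a factor
  `D+1` in `r`.  Why easier in this form: every object is now a scalar or a LINEAR form, the
  identity lives in the single degree `n`, and by Newton's identities
  `e_n(m_i) = Q_n(p_1(m_i), …, p_n(m_i))` with power sums `p_k(m_i) = Σ_j m_ij^k` — the degree `D`
  enters only as a bound on the Waring rank of the `n` power-sum forms of each summand, which
  separates the roles of `r` (number of summands) and `D` (inner rank); apolarity / catalecticant
  and representation-theoretic tools apply without inhomogeneous bookkeeping.  Why it might fail: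
  as the crux (a permanent analogue of the Nisan–Wigderson/Ben-Or phenomenon for `e_n`, i.e. an
  expression with `2^(n−ω(log n))` wires at super-linear `D`), and additionally by a degree-`n`-only
  identity exploiting the forgotten graded constraints — in which case the graded e-system
  (`∀ k`, with the translated targets `[per_n(x+u)]_k`), which is EQUIVALENT to the crux's
  high-degree regime, replaces H.  Flattenings prove H for `D ≤ n + O(log n)` (same count as F);
  beyond that they certify only `r ≥ max_k binom(n,k)²/binom(D,k) = 2^(Θ(n²/D))` — numerically
  `2^(0.51n)` at `D = 2n`, `2^(0.35n)` at `D = 3n`, `2^(0.2n)` at `D = 5n` (n = 100), polynomial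
  from `D ≈ n²/log n` on — never `2^n/poly(n)`; the known unconditional depth-three bounds for
  `per_n` over `ℂ` are polynomial (Shpilka–Wigderson) resp. `n^(Ω(√log n))`-type (LST 2021).

Composition `RyserOptimalDepth3_of` (sorry-free, by cases on the degree dial): take `t, c₁` from H
and `c₂ = c(t)` from F; given an affine expression, if `D ≤ n + t⌊log₂(n+2)⌋` apply F, else pass to
the normal form (N) and apply H; in both cases enlarge the exponent to `c₁ + c₂`.  All three stubs
are load-bearing and DEF-FREE beyond Mathlib + `Literature.Computability.AlgebraicComplexity.perPoly`
(so each can land as `Theorems/SummationBitsRyserOptimalDepth3<Stub>.lean` with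
`--supports stmt-ValiantsHypothesis-7565`).

Disproof used: none exists for this crux (`ledger crux ls stmt-ValiantsHypothesis-7565`: no
workfiles before this one); the summit's negatives index (4 refuted statements: determinantal
representations / elusive candidates) is unrelated to depth-three expressions; refuter notes on the
item (g40-54, g41-51, g44-27) read the statement back (affine factors, empty product, `r = 0`,
monotone in `r, D`) and found nothing against it.

BC3 audit (registering seat planner-skel-stmt-ValiantsHypothesis-7565-0, 2026-08-17):
`lean check --json` rc 0, errors [], sorries 3 = exactly the three `stub_*` theorems of §2, zero
elsewhere; `#print axioms RyserOptimalDepth3_of` = [propext, Classical.choice, Quot.sound].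
Probes (`bc/RyserOptimalDepth3_probe.lean` of the seat: §1 of this file verbatim, NO sorried
declaration, for each stub `example : Sig.stub_X → RyserOptimalDepth3` and
`example : Sig.stub_X → _root_.ValiantsHypothesis`, weak form `first | exact? | simpa | aesop` and
strong form `first | exact? | simpa [S, T] | (unfold S T; simpa) | aesop (add norm unfold [S, T])`,
`maxHeartbeats 400000`): rc 1 with TWELVE "unsolved goals" errors (one per probe) and twelve
"aesop: failed to prove the goal after exhaustive search" — no stub is cheaply the crux or the summit.

Shape (skeleton audit by-name rule, as `Cruxes/ChowBorderBound/Lines/birth.lean`): §1 the stub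
statements as named Props `Sig.stub_*` · §2 the registered sorried stubs `stub_*` with the
statements spelled out (`sorry` lives only there) · §3 `RyserOptimalDepth3_of` (hypotheses = the
`Sig` Props, conclusion = the route decl BY NAME) and the hypothesis-free `RyserOptimalDepth3_proof`
(the compiler checks that the `Sig` copies and the stub statements agree).
-/

set_option linter.dupNamespace false

namespace Summit.ValiantsHypothesis.ValiantsHypothesis.Cruxes.RyserOptimalDepth3.Birth

open MvPolynomial
open Literature.Computability.AlgebraicComplexity
open scoped BigOperators

/-! ## §1 The stub statements as named propositions -/

namespace Sig

/-- **Stub F** — the flattening regime `D ≤ n + t⌊log₂(n+2)⌋` (true; M): Ryser is optimal up to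
`(n+2)^(t+1)` among affine depth-three expressions of near-homogeneous degree. -/
def stub_flatteningRegime : Prop :=
  ∀ t : ℕ, ∃ c : ℕ, ∀ n : ℕ, 1 ≤ n →
    ∀ (r D : ℕ) (ℓ : Fin r → Fin D → MvPolynomial (Fin n × Fin n) ℂ),
      (∀ i j, (ℓ i j).totalDegree ≤ 1) → (∑ i, ∏ j, ℓ i j) = perPoly (Fin n) ℂ →
        D ≤ n + t * Nat.log 2 (n + 2) → 2 ^ n ≤ r * (D + 1) * (n + 2) ^ c

/-- **Stub N** — elementary-symmetric normal form (true; M): an affine expression with parameters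
`(r, D)` gives `per_n = Σ_i a_i e_n(m_i1, …, m_iD)` with linear forms `m_ij`, same `r, D`. -/
def stub_esymNormalForm : Prop :=
  ∀ n : ℕ, 1 ≤ n →
    ∀ (r D : ℕ) (ℓ : Fin r → Fin D → MvPolynomial (Fin n × Fin n) ℂ),
      (∀ i j, (ℓ i j).totalDegree ≤ 1) → (∑ i, ∏ j, ℓ i j) = perPoly (Fin n) ℂ →
        ∃ (a : Fin r → ℂ) (m : Fin r → Fin D → MvPolynomial (Fin n × Fin n) ℂ),
          (∀ i j, (m i j).IsHomogeneous 1) ∧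
            (∑ i, C (a i) * aeval (m i) (esymm (Fin D) ℂ n)) = perPoly (Fin n) ℂ

/-- **Stub H** — the heart (OPEN): in the interpolation regime `D > n + t⌊log₂(n+2)⌋`,
representations of `per_n` by `r` elementary symmetric polynomials of degree `n` in `D` linear
forms have `2^n ≤ r (D+1) (n+2)^c`. -/
def stub_esymHighDegree : Prop :=
  ∃ t c : ℕ, ∀ n : ℕ, 1 ≤ n →
    ∀ (r D : ℕ) (a : Fin r → ℂ) (m : Fin r → Fin D → MvPolynomial (Fin n × Fin n) ℂ),
      (∀ i j, (m i j).IsHomogeneous 1) →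
        (∑ i, C (a i) * aeval (m i) (esymm (Fin D) ℂ n)) = perPoly (Fin n) ℂ →
          n + t * Nat.log 2 (n + 2) < D → 2 ^ n ≤ r * (D + 1) * (n + 2) ^ c

end Sig

/-! ## §2 The registered stubs (statements spelled out; `sorry` lives only here) -/

/-- **Stub F (registered)** — FLATTENING REGIME: for every `t` there is `c` such that for all
`n ≥ 1`, every affine expression `per_n = Σ_{i<r} Π_{j<D} ℓ_ij` with `D ≤ n + t⌊log₂(n+2)⌋` has
`2^n ≤ r (D+1) (n+2)^c`.  Method of partial derivatives at order `⌊n/2⌋`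
(`iterPDeriv_prod_mem_span` with index type `Fin D`, `flatteningRank_perPoly`,
`binom(D,k) ≤ 2^(D-n) binom(n,k)`, `(n+1) binom(n,⌊n/2⌋) ≥ 2^n`); `c = t + 1`.
[cite: NisanWigderson1996, §3] [cite: LandsbergGCT2017, Prop. 7.2.2.1] -/
theorem stub_flatteningRegime :
    ∀ t : ℕ, ∃ c : ℕ, ∀ n : ℕ, 1 ≤ n →
      ∀ (r D : ℕ) (ℓ : Fin r → Fin D → MvPolynomial (Fin n × Fin n) ℂ),
        (∀ i j, (ℓ i j).totalDegree ≤ 1) → (∑ i, ∏ j, ℓ i j) = perPoly (Fin n) ℂ →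
          D ≤ n + t * Nat.log 2 (n + 2) → 2 ^ n ≤ r * (D + 1) * (n + 2) ^ c := by
  sorry

/-- **Stub N (registered)** — ELEMENTARY-SYMMETRIC NORMAL FORM: for `n ≥ 1`, an affine expression
`per_n = Σ_{i<r} Π_{j<D} ℓ_ij` yields scalars `a_i` and degree-1-homogeneous `m_ij` with
`Σ_i a_i · e_n(m_i1, …, m_iD) = per_n`.  Generic translation `x ↦ x + u` (all non-zero factors get a
non-zero constant term), division by the constant terms, degree-`n` homogeneous component
(`homogeneousComponent_prod_one_add`; the top component of `per_n(x+u)` is `per_n`).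
[cite: Shpilka2002, symmetric model of depth three] -/
theorem stub_esymNormalForm :
    ∀ n : ℕ, 1 ≤ n →
      ∀ (r D : ℕ) (ℓ : Fin r → Fin D → MvPolynomial (Fin n × Fin n) ℂ),
        (∀ i j, (ℓ i j).totalDegree ≤ 1) → (∑ i, ∏ j, ℓ i j) = perPoly (Fin n) ℂ →
          ∃ (a : Fin r → ℂ) (m : Fin r → Fin D → MvPolynomial (Fin n × Fin n) ℂ),
            (∀ i j, (m i j).IsHomogeneous 1) ∧
              (∑ i, C (a i) * aeval (m i) (esymm (Fin D) ℂ n)) = perPoly (Fin n) ℂ := by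
  sorry

/-- **Stub H (registered)** — THE HEART (open): there are `t, c` such that for all `n ≥ 1`, every
representation `Σ_{i<r} a_i e_n(m_i1, …, m_iD) = per_n` with linear forms `m_ij` and
`D > n + t⌊log₂(n+2)⌋` has `2^n ≤ r (D+1) (n+2)^c`.  Known: flattenings give it for
`D ≤ n + O(log n)` and only `r ≥ 2^(Θ(n²/D))` beyond (`2^(0.51n)` at `D = 2n`, polynomial from
`D ≈ n²/log n` on); unconditionally only polynomial / `n^(Ω(√log n))`-type bounds are known.
[cite: NisanWigderson1996] [cite: ShpilkaWigderson2001] [cite: Glynn2010] -/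
theorem stub_esymHighDegree :
    ∃ t c : ℕ, ∀ n : ℕ, 1 ≤ n →
      ∀ (r D : ℕ) (a : Fin r → ℂ) (m : Fin r → Fin D → MvPolynomial (Fin n × Fin n) ℂ),
        (∀ i j, (m i j).IsHomogeneous 1) →
          (∑ i, C (a i) * aeval (m i) (esymm (Fin D) ℂ n)) = perPoly (Fin n) ℂ →
            n + t * Nat.log 2 (n + 2) < D → 2 ^ n ≤ r * (D + 1) * (n + 2) ^ c := by
  sorry

/-! ## §3 Composition (sorry-free) -/

/-- **The line closes the crux**: flattening regime (F) + normal form (N) + the heart (H) give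
`SummationBits.RyserOptimalDepth3` BY NAME, with exponent `c₁ + c₂` (`c₁` from H, `c₂ = c(t)` from F
at the `t` of H), by cases on the degree dial `D ≤ n + t⌊log₂(n+2)⌋`. -/
theorem RyserOptimalDepth3_of :
    Sig.stub_flatteningRegime → Sig.stub_esymNormalForm → Sig.stub_esymHighDegree →
      Summit.ValiantsHypothesis.ValiantsHypothesis.Theses.SummationBits.RyserOptimalDepth3 := by
  intro hF hN hH
  obtain ⟨t, c₁, hH⟩ := hH
  obtain ⟨c₂, hF⟩ := hF t
  refine ⟨c₁ + c₂, fun n hn r D ℓ hℓ hsum => ?_⟩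
  -- enlarging the exponent is harmless (`n + 2 ≥ 1`)
  have hmono : ∀ c : ℕ, c ≤ c₁ + c₂ → 2 ^ n ≤ r * (D + 1) * (n + 2) ^ c →
      2 ^ n ≤ r * (D + 1) * (n + 2) ^ (c₁ + c₂) := fun c hc h =>
    h.trans (Nat.mul_le_mul_left _ (Nat.pow_le_pow_right (by omega) hc))
  by_cases hD : D ≤ n + t * Nat.log 2 (n + 2)
  · -- flattening regime: F at `t`
    exact hmono c₂ (by omega) (hF n hn r D ℓ hℓ hsum hD)
  · -- interpolation regime: elementary-symmetric normal form (N), then the heart (H)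
    obtain ⟨a, m, hm, hsum'⟩ := hN n hn r D ℓ hℓ hsum
    exact hmono c₁ (by omega) (hH n hn r D a m hm hsum' (by omega))

/-- THE SKELETON: the crux, modulo exactly the three registered stubs (the compiler checks that the
`Sig` copies and the stub statements agree). -/
theorem RyserOptimalDepth3_proof :
    Summit.ValiantsHypothesis.ValiantsHypothesis.Theses.SummationBits.RyserOptimalDepth3 :=
  RyserOptimalDepth3_of stub_flatteningRegime stub_esymNormalForm stub_esymHighDegree

end Summit.ValiantsHypothesis.ValiantsHypothesis.Cruxes.RyserOptimalDepth3.Birth
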